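import Mathlib

/-!
# Stein displacement toolkit for the lower shift (hidden-corner lemma, crux stmt-MatrixMultiplication-10752)

Support file for crux item `stmt-MatrixMultiplication-10752`
(`Summit.MatrixMultiplication.MatrixMultiplication.Theses.HiddenToeplitzCorners.HiddenCornerLemmaR`).
Elementary facts about the lower shift `Z` (`Z i j = [i = j+1]`, written verbatim as in the crux) and
the Stein displacement `M ↦ M − Z M Zᵀ`:

* `hclR_shift_pow_apply`, `hclR_shift_pow_N` — entries of `Z^k`, nilpotency `Z^N = 0`;
* `hclR_eq_zero_of_stein` — uniqueness: `M = Z M Zᵀ → M = 0`;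
* `hclR_stein_sum`, `hclR_eq_stein_sum` — rank-one Stein inversion `T = Σ_{k<N} Z^k (u ⊗ v) (Zᵀ)^k`;
* `hclR_shiftT_pow_mulVec`, `hclR_shift_pow_mulVec`, `hclR_stein_sum_mulVec`, `hclR_dot_shiftT_pow` —
  the Stein sum applied to a vector is `Σ_k corr(v,e)_k • Z^k u` with `corr(v,e)_k = Σ_m v m · e (m+k)`;
* `hclR_corr_eq_zero_of_lt`, `hclR_corr_ne_zero_at` — valuation/degree behaviour of `corr`;
* `hclR_coeff_eq_zero_of_sum_smul_shift` — triangular injectivity of `c ↦ Σ c_k • Z^k u` when `u 0 ≠ 0`;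
* `hclR_stein_sum_row_zero` — row `0` of the Stein sum is `u 0 • v`.

All statements are over `ℂ` and `Fin N`, matching the crux binders. [folklore]
-/

set_option linter.dupNamespace false

namespace Summit.MatrixMultiplication.MatrixMultiplication.Theorems

open Matrix BigOperators Finset

section corr

variable {N : ℕ}

/-- Entries of powers of the lower shift: `(Z^k) i j = 1` iff `i = j + k`. -/
theorem hclR_shift_pow_apply (k : ℕ) (i j : Fin N) :
    ((Matrix.of fun i j : Fin N => if (i : ℕ) = (j : ℕ) + 1 then (1 : ℂ) else 0) ^ k) i j =
      if (i : ℕ) = (j : ℕ) + k then 1 else 0 := by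
  induction k generalizing i j with
  | zero => simp [Matrix.one_apply, Fin.ext_iff]
  | succ k ih =>
    rw [pow_succ, Matrix.mul_apply]
    simp only [ih, Matrix.of_apply, mul_ite, mul_one, mul_zero]
    by_cases h : (i : ℕ) = (j : ℕ) + (k + 1)
    · rw [if_pos h]
      have hj : (j : ℕ) + 1 < N := by omega
      rw [Finset.sum_eq_single ⟨(j : ℕ) + 1, hj⟩]
      · simp [h]; omega
      · intro b _ hb
        have : ¬ ((b : ℕ) = (j : ℕ) + 1) := fun h' => hb (Fin.ext h')
        simp [this]
      · simp
    · rw [if_neg h]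
      apply Finset.sum_eq_zero
      intro b _
      by_cases h1 : (b : ℕ) = (j : ℕ) + 1
      · have h2 : ¬ ((i : ℕ) = (j : ℕ) + 1 + k) := by omega
        simp [h1, h2]
      · simp [h1]

/-- The lower shift is nilpotent: `Z^N = 0`. -/
theorem hclR_shift_pow_N :
    (Matrix.of fun i j : Fin N => if (i : ℕ) = (j : ℕ) + 1 then (1 : ℂ) else 0) ^ N = 0 := by
  ext i j
  rw [hclR_shift_pow_apply]
  have := i.2
  simp; omega

/-- Stein uniqueness: `M = Z M Zᵀ` forces `M = 0`. -/
theorem hclR_eq_zero_of_stein (M : Matrix (Fin N) (Fin N) ℂ)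
    (h : M = (Matrix.of fun i j : Fin N => if (i : ℕ) = (j : ℕ) + 1 then (1 : ℂ) else 0) * M *
      (Matrix.of fun i j : Fin N => if (i : ℕ) = (j : ℕ) + 1 then (1 : ℂ) else 0)ᵀ) : M = 0 := by
  set Z := (Matrix.of fun i j : Fin N => if (i : ℕ) = (j : ℕ) + 1 then (1 : ℂ) else 0) with hZ
  have key : ∀ n : ℕ, M = Z ^ n * M * (Zᵀ) ^ n := by
    intro n
    induction n with
    | zero => simp
    | succ n ih =>
      calc M = Z ^ n * M * (Zᵀ) ^ n := ih
        _ = Z ^ n * (Z * M * Zᵀ) * (Zᵀ) ^ n := by rw [← h]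
        _ = Z ^ (n + 1) * M * (Zᵀ) ^ (n + 1) := by
          rw [pow_succ, pow_succ']; simp only [Matrix.mul_assoc]
  rw [key N, hZ, hclR_shift_pow_N]; simp

/-- Stein inversion, rank-one case: `S := Σ_{k<N} Z^k (u ⊗ v) (Zᵀ)^k` has displacement `u ⊗ v`. -/
theorem hclR_stein_sum (u v : Fin N → ℂ) :
    (∑ k ∈ Finset.range N, (Matrix.of fun i j : Fin N => if (i : ℕ) = (j : ℕ) + 1 then (1 : ℂ) else 0) ^ k *
        Matrix.vecMulVec u v * ((Matrix.of fun i j : Fin N => if (i : ℕ) = (j : ℕ) + 1 then (1 : ℂ) else 0)ᵀ) ^ k) -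
      (Matrix.of fun i j : Fin N => if (i : ℕ) = (j : ℕ) + 1 then (1 : ℂ) else 0) *
      (∑ k ∈ Finset.range N, (Matrix.of fun i j : Fin N => if (i : ℕ) = (j : ℕ) + 1 then (1 : ℂ) else 0) ^ k *
        Matrix.vecMulVec u v * ((Matrix.of fun i j : Fin N => if (i : ℕ) = (j : ℕ) + 1 then (1 : ℂ) else 0)ᵀ) ^ k) *
      (Matrix.of fun i j : Fin N => if (i : ℕ) = (j : ℕ) + 1 then (1 : ℂ) else 0)ᵀ
      = Matrix.vecMulVec u v := by
  set Z := (Matrix.of fun i j : Fin N => if (i : ℕ) = (j : ℕ) + 1 then (1 : ℂ) else 0) with hZ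
  set D := Matrix.vecMulVec u v
  have hstep : ∀ k : ℕ, Z * (Z ^ k * D * (Zᵀ) ^ k) * Zᵀ = Z ^ (k + 1) * D * (Zᵀ) ^ (k + 1) := by
    intro k; rw [pow_succ', pow_succ]; simp only [Matrix.mul_assoc]
  rw [Finset.mul_sum, Finset.sum_mul]
  simp_rw [hstep]
  -- telescoping: Σ_{k<N} f k - Σ_{k<N} f (k+1) = f 0 - f N
  have tel : ∀ n : ℕ, (∑ k ∈ Finset.range n, Z ^ k * D * (Zᵀ) ^ k) -
      (∑ k ∈ Finset.range n, Z ^ (k + 1) * D * (Zᵀ) ^ (k + 1)) = D - Z ^ n * D * (Zᵀ) ^ n := by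
    intro n
    induction n with
    | zero => simp
    | succ n ih =>
      rw [Finset.sum_range_succ, Finset.sum_range_succ]
      have : (∑ k ∈ Finset.range n, Z ^ k * D * (Zᵀ) ^ k) + Z ^ n * D * (Zᵀ) ^ n -
          ((∑ k ∈ Finset.range n, Z ^ (k + 1) * D * (Zᵀ) ^ (k + 1)) + Z ^ (n + 1) * D * (Zᵀ) ^ (n + 1)) =
          ((∑ k ∈ Finset.range n, Z ^ k * D * (Zᵀ) ^ k) -
          (∑ k ∈ Finset.range n, Z ^ (k + 1) * D * (Zᵀ) ^ (k + 1))) +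
          (Z ^ n * D * (Zᵀ) ^ n - Z ^ (n + 1) * D * (Zᵀ) ^ (n + 1)) := by abel
      rw [this, ih]; abel
  rw [tel N, hZ, hclR_shift_pow_N]; simp

/-- From the displacement equation, each coefficient matrix IS the Stein sum. -/
theorem hclR_eq_stein_sum (M : Matrix (Fin N) (Fin N) ℂ) (u v : Fin N → ℂ)
    (h : M - (Matrix.of fun i j : Fin N => if (i : ℕ) = (j : ℕ) + 1 then (1 : ℂ) else 0) * M *
      (Matrix.of fun i j : Fin N => if (i : ℕ) = (j : ℕ) + 1 then (1 : ℂ) else 0)ᵀ = Matrix.vecMulVec u v) :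
    M = ∑ k ∈ Finset.range N, (Matrix.of fun i j : Fin N => if (i : ℕ) = (j : ℕ) + 1 then (1 : ℂ) else 0) ^ k *
        Matrix.vecMulVec u v * ((Matrix.of fun i j : Fin N => if (i : ℕ) = (j : ℕ) + 1 then (1 : ℂ) else 0)ᵀ) ^ k := by
  set Z := (Matrix.of fun i j : Fin N => if (i : ℕ) = (j : ℕ) + 1 then (1 : ℂ) else 0) with hZ
  set S := ∑ k ∈ Finset.range N, Z ^ k * Matrix.vecMulVec u v * (Zᵀ) ^ k with hS
  have hS' : S - Z * S * Zᵀ = Matrix.vecMulVec u v := by rw [hS, hZ]; exact hclR_stein_sum u v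
  have hdiff : (M - S) = Z * (M - S) * Zᵀ := by
    have e1 : M - S - Z * (M - S) * Zᵀ = (M - Z * M * Zᵀ) - (S - Z * S * Zᵀ) := by
      simp only [Matrix.mul_sub, Matrix.sub_mul]; abel
    have : M - S - Z * (M - S) * Zᵀ = 0 := by rw [e1, h, hS', sub_self]
    exact sub_eq_zero.mp this
  have := hclR_eq_zero_of_stein (M - S) (by rw [hZ] at hdiff; exact hdiff)
  exact sub_eq_zero.mp this

/-- Entries of `(Zᵀ)^k *ᵥ e`: the `k`-fold up-shift. -/
theorem hclR_shiftT_pow_mulVec (k : ℕ) (e : Fin N → ℂ) (m : Fin N) :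
    (((Matrix.of fun i j : Fin N => if (i : ℕ) = (j : ℕ) + 1 then (1 : ℂ) else 0)ᵀ) ^ k *ᵥ e) m =
      if h : (m : ℕ) + k < N then e ⟨(m : ℕ) + k, h⟩ else 0 := by
  rw [← Matrix.transpose_pow, Matrix.mulVec, dotProduct]
  simp only [Matrix.transpose_apply, hclR_shift_pow_apply]
  by_cases h : (m : ℕ) + k < N
  · rw [dif_pos h, Finset.sum_eq_single ⟨(m : ℕ) + k, h⟩]
    · simp
    · intro b _ hb
      have : ¬ ((b : ℕ) = (m : ℕ) + k) := fun h' => hb (Fin.ext h')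
      simp [this]
    · simp
  · rw [dif_neg h]
    apply Finset.sum_eq_zero
    intro b _
    have : ¬ ((b : ℕ) = (m : ℕ) + k) := by have := b.2; omega
    simp [this]

/-- Entries of `Z^k *ᵥ u`: the `k`-fold down-shift. -/
theorem hclR_shift_pow_mulVec (k : ℕ) (u : Fin N → ℂ) (i : Fin N) :
    ((Matrix.of fun i j : Fin N => if (i : ℕ) = (j : ℕ) + 1 then (1 : ℂ) else 0) ^ k *ᵥ u) i =
      if h : k ≤ (i : ℕ) then u ⟨(i : ℕ) - k, by omega⟩ else 0 := by
  rw [Matrix.mulVec, dotProduct]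
  simp only [hclR_shift_pow_apply]
  by_cases h : k ≤ (i : ℕ)
  · rw [dif_pos h, Finset.sum_eq_single ⟨(i : ℕ) - k, by omega⟩]
    · simp; omega
    · intro b _ hb
      have : ¬ ((i : ℕ) = (b : ℕ) + k) := fun h' => hb (Fin.ext (by simp; omega))
      simp [this]
    · simp
  · rw [dif_neg h]
    apply Finset.sum_eq_zero
    intro b _
    have : ¬ ((i : ℕ) = (b : ℕ) + k) := by omega
    simp [this]

/-- The Stein sum applied to a vector: `S *ᵥ e = Σ_k (v ⬝ (Zᵀ)^k e) • Z^k u`. -/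
theorem hclR_stein_sum_mulVec (u v e : Fin N → ℂ) :
    (∑ k ∈ Finset.range N, (Matrix.of fun i j : Fin N => if (i : ℕ) = (j : ℕ) + 1 then (1 : ℂ) else 0) ^ k *
        Matrix.vecMulVec u v * ((Matrix.of fun i j : Fin N => if (i : ℕ) = (j : ℕ) + 1 then (1 : ℂ) else 0)ᵀ) ^ k) *ᵥ e
      = ∑ k ∈ Finset.range N, (v ⬝ᵥ (((Matrix.of fun i j : Fin N => if (i : ℕ) = (j : ℕ) + 1 then (1 : ℂ) else 0)ᵀ) ^ k *ᵥ e)) •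
        ((Matrix.of fun i j : Fin N => if (i : ℕ) = (j : ℕ) + 1 then (1 : ℂ) else 0) ^ k *ᵥ u) := by
  rw [Matrix.sum_mulVec]
  refine Finset.sum_congr rfl fun k _ => ?_
  rw [← Matrix.mulVec_mulVec, ← Matrix.mulVec_mulVec, Matrix.vecMulVec_mulVec, Matrix.mulVec_smul,
    op_smul_eq_smul]

/-- Correlation coefficient `corr v e k = Σ_m v m · e (m+k)` written as a dot product. -/
theorem hclR_dot_shiftT_pow (k : ℕ) (v e : Fin N → ℂ) :
    v ⬝ᵥ (((Matrix.of fun i j : Fin N => if (i : ℕ) = (j : ℕ) + 1 then (1 : ℂ) else 0)ᵀ) ^ k *ᵥ e) =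
      ∑ m : Fin N, v m * (if h : (m : ℕ) + k < N then e ⟨(m : ℕ) + k, h⟩ else 0) := by
  rw [dotProduct]
  refine Finset.sum_congr rfl fun m _ => ?_
  rw [hclR_shiftT_pow_mulVec]

/-- Valuation bound: if `v` vanishes below `ν`, `e` vanishes above `δ`, and `δ < ν`… more precisely:
if every index `m` with `v m ≠ 0` has `ν ≤ m` and every `i` with `e i ≠ 0` has `i ≤ δ`, and `δ < ν`,
then all correlations vanish. -/
theorem hclR_corr_eq_zero_of_lt (v e : Fin N → ℂ) (ν δ : ℕ)
    (hv : ∀ m : Fin N, v m ≠ 0 → ν ≤ (m : ℕ)) (he : ∀ i : Fin N, e i ≠ 0 → (i : ℕ) ≤ δ) (hlt : δ < ν)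
    (k : ℕ) : (∑ m : Fin N, v m * (if h : (m : ℕ) + k < N then e ⟨(m : ℕ) + k, h⟩ else 0)) = 0 := by
  apply Finset.sum_eq_zero
  intro m _
  by_cases hvm : v m = 0
  · simp [hvm]
  · have h1 := hv m hvm
    by_cases h : (m : ℕ) + k < N
    · rw [dif_pos h]
      have : e ⟨(m : ℕ) + k, h⟩ = 0 := by
        by_contra hne
        have := he _ hne
        simp at this; omega
      simp [this]
    · simp [h]

/-- Valuation witness: with `ν` the least index of a nonzero entry of `v` and `δ` the largest index of
a nonzero entry of `e`, if `ν ≤ δ` then the correlation at lag `δ − ν` is `v ν * e δ ≠ 0`. -/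
theorem hclR_corr_ne_zero_at (v e : Fin N → ℂ) (ν δ : Fin N)
    (hvν : v ν ≠ 0) (hv : ∀ m : Fin N, v m ≠ 0 → (ν : ℕ) ≤ m)
    (heδ : e δ ≠ 0) (he : ∀ i : Fin N, e i ≠ 0 → (i : ℕ) ≤ δ) (hle : (ν : ℕ) ≤ δ) :
    (∑ m : Fin N, v m * (if h : (m : ℕ) + ((δ : ℕ) - ν) < N then e ⟨(m : ℕ) + ((δ : ℕ) - ν), h⟩ else 0)) ≠ 0 := by
  rw [Finset.sum_eq_single ν]
  · have h : (ν : ℕ) + ((δ : ℕ) - ν) < N := by have := δ.2; omega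
    rw [dif_pos h]
    have : (⟨(ν : ℕ) + ((δ : ℕ) - ν), h⟩ : Fin N) = δ := Fin.ext (by simp; omega)
    rw [this]
    exact mul_ne_zero hvν heδ
  · intro m _ hm
    by_cases hvm : v m = 0
    · simp [hvm]
    · have h1 := hv m hvm
      have h2 : (ν : ℕ) < m := lt_of_le_of_ne h1 (fun h => hm (Fin.ext h.symm))
      by_cases h : (m : ℕ) + ((δ : ℕ) - ν) < N
      · rw [dif_pos h]
        have : e ⟨(m : ℕ) + ((δ : ℕ) - ν), h⟩ = 0 := by
          by_contra hne
          have := he _ hne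
          simp at this; omega
        simp [this]
      · simp [h]
  · simp

/-- Triangular injectivity: if `u 0 ≠ 0` then `c ↦ Σ_{k<N} c k • Z^k u` is injective. -/
theorem hclR_coeff_eq_zero_of_sum_smul_shift (u : Fin N → ℂ) (c : ℕ → ℂ) (h0 : 0 < N)
    (hu : u ⟨0, h0⟩ ≠ 0)
    (hc : ∑ k ∈ Finset.range N, c k • ((Matrix.of fun i j : Fin N => if (i : ℕ) = (j : ℕ) + 1 then (1 : ℂ) else 0) ^ k *ᵥ u) = 0) :
    ∀ k, k < N → c k = 0 := by
  intro k
  induction k using Nat.strong_induction_on with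
  | _ k ih =>
    intro hk
    have := congr_fun hc ⟨k, hk⟩
    simp only [Finset.sum_apply, Pi.smul_apply, hclR_shift_pow_mulVec, smul_eq_mul, Pi.zero_apply] at this
    rw [Finset.sum_eq_single k] at this
    · simp only [le_refl, Nat.sub_self, dite_true] at this
      rcases mul_eq_zero.mp this with h | h
      · exact h
      · exact absurd h hu
    · intro j hj hjk
      rw [Finset.mem_range] at hj
      by_cases hle : j ≤ k
      · have hlt : j < k := lt_of_le_of_ne hle hjk
        rw [ih j hlt hj]; simp
      · simp [hle]
    · intro hk'; exact absurd (Finset.mem_range.mpr hk) hk'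

/-- Row `0` of the Stein sum is `u 0 • v`. -/
theorem hclR_stein_sum_row_zero (u v : Fin N → ℂ) (h0 : 0 < N) (j : Fin N) :
    (∑ k ∈ Finset.range N, (Matrix.of fun i j : Fin N => if (i : ℕ) = (j : ℕ) + 1 then (1 : ℂ) else 0) ^ k *
        Matrix.vecMulVec u v * ((Matrix.of fun i j : Fin N => if (i : ℕ) = (j : ℕ) + 1 then (1 : ℂ) else 0)ᵀ) ^ k)
        ⟨0, h0⟩ j = u ⟨0, h0⟩ * v j := by
  rw [Matrix.sum_apply]
  rw [Finset.sum_eq_single 0]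
  · simp [Matrix.vecMulVec_apply]
  · intro k _ hk
    rw [Matrix.mul_assoc, Matrix.mul_apply]
    apply Finset.sum_eq_zero
    intro l _
    rw [hclR_shift_pow_apply]
    have : ¬ ((0 : ℕ) = (l : ℕ) + k) := by omega
    simp [this]
  · intro h; simp at h; omega

end corr

end Summit.MatrixMultiplication.MatrixMultiplication.Theorems
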